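import Literature.NumberTheory.EllipticCurves.OggWildThreeSwanProofs
import HarnessLib

/-!
# `Sw_𝔓(V₂ E) = v(disc) - 2` from an Eisenstein rescaling `θ = λ·e` of the roots of the
# `2`-division cubic (Kodaira types `II` and `IV*` at `p = 3`; Silverman *ATAEC* IV.11.1)

`Proofs` file (theorems only, no definitions, no named facts), sequel of `OggWildThreeSwanProofs`
(same seat, bsd.S15): the `2`-division field `F = K(e₁, e₂, e₃) ⊆ K̄` is set up once and for all
(`rootSet_twoTorsionPolynomial_eq`, `algEquiv_eq_one_of_apply_roots_eq`: it is finite Galois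
and `Gal(F/K)` acts faithfully on the `eᵢ`), and the Galois-side theorem
`swanConductorAt_rationalTate_two_eq_of_eisenstein` is specialised to **`θᵢ = λeᵢ`**:

* `WeierstrassCurve.swanConductorAt_rationalTate_two_eq_of_linear` — if for some `λ ∈ Kˣ` the
  monic cubic with roots `λeᵢ`, i.e. `X³ + c₂X² + c₁X + c₀` with `4c₂ = λb₂`, `2c₁ = λ²b₄`,
  `4c₀ = λ³b₆`, has coefficients in `𝓞 K` and is Eisenstein at a place `v` of residue
  characteristic `3`, then `Sw_𝔓(V₂ E) = v(disc(c)) - 2` for every `𝔓 ∣ v`.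

What is left to the curve side for the Kodaira types `II` (`λ = 1` at a `v`-minimal model in
Tate's normal form, `v(b₂), v(b₄) ≥ 1 = v(b₆)`, `disc = 16Δ`) and `IV*` (`λ = s/π`,
`v(b₂) ≥ 2, v(b₄) ≥ 3, v(b₆) = 4`) is local algebra at `v` plus `v(disc) - 2 = δ_v`
(*ATAEC* p. 368, table, and p. 371).  The quadratic rescaling `θ = λe²` (types `IV`, `II*`) is
the object of a sequel.

No definitions, no named facts.  All axioms `propext`, `Classical.choice`, `Quot.sound`.

## References

* J. H. Silverman, *Advanced Topics in the Arithmetic of Elliptic Curves*, GTM 151 (1994), proof of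
  Thm. IV.11.1 for `p = 3` (PDF pp. 366–371). [SilvermanATAEC1994]
-/

noncomputable section

open scoped Classical NumberField
open Field IsDedekindDomain Polynomial

universe u

namespace WeierstrassCurve

open Literature.NumberTheory.EllipticCurves Literature.NumberTheory.GaloisRepresentations
  IsDedekindDomain.HeightOneSpectrum

variable {K : Type u} [Field K] [NumberField K] (W : WeierstrassCurve K)

omit [NumberField K] in
/-- The root set of the `2`-division cubic in `K̄` is `{e₁, e₂, e₃}`. [folklore] -/
theorem rootSet_twoTorsionPolynomial_eq {e₁ e₂ e₃ : AlgebraicClosure K}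
    (h3 : (Cubic.map (algebraMap K (AlgebraicClosure K)) W.twoTorsionPolynomial).roots = {e₁, e₂, e₃}) :
    W.twoTorsionPolynomial.toPoly.rootSet (AlgebraicClosure K) = {e₁, e₂, e₃} := by
  ext x
  rw [Polynomial.rootSet_def, Finset.mem_coe, Multiset.mem_toFinset, Polynomial.aroots_def,
    ← Cubic.map_toPoly, ← Cubic.roots, h3]
  simp

/-- An automorphism of `F = K(e₁, e₂, e₃)` fixing the `eᵢ` is the identity. [folklore] -/
theorem algEquiv_eq_one_of_apply_roots_eq {e₁ e₂ e₃ : AlgebraicClosure K}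
    (h3 : (Cubic.map (algebraMap K (AlgebraicClosure K)) W.twoTorsionPolynomial).roots = {e₁, e₂, e₃})
    {F : IntermediateField K (AlgebraicClosure K)}
    (hF : F = IntermediateField.adjoin K (W.twoTorsionPolynomial.toPoly.rootSet (AlgebraicClosure K)))
    (he₁ : e₁ ∈ F) (he₂ : e₂ ∈ F) (he₃ : e₃ ∈ F) (g : F ≃ₐ[K] F)
    (h₁ : g ⟨e₁, he₁⟩ = ⟨e₁, he₁⟩) (h₂ : g ⟨e₂, he₂⟩ = ⟨e₂, he₂⟩) (h₃ : g ⟨e₃, he₃⟩ = ⟨e₃, he₃⟩) :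
    g = 1 := by
  subst hF
  apply AlgEquiv.ext
  intro x
  rw [AlgEquiv.one_apply]
  obtain ⟨x, hx⟩ := x
  -- induction on `x ∈ K(rootSet)`
  suffices H : ∀ (y : AlgebraicClosure K) (hy : y ∈ IntermediateField.adjoin K
      (W.twoTorsionPolynomial.toPoly.rootSet (AlgebraicClosure K))), (g ⟨y, hy⟩ : AlgebraicClosure K) = y by
    exact Subtype.ext (H x hx)
  intro y hy
  refine IntermediateField.adjoin_induction K (p := fun y hy ↦ (g ⟨y, hy⟩ : AlgebraicClosure K) = y)
    ?_ ?_ ?_ ?_ ?_ hy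
  · intro t ht
    rw [W.rootSet_twoTorsionPolynomial_eq h3] at ht
    have ht' := ht
    simp only [Set.mem_insert_iff, Set.mem_singleton_iff] at ht'
    rcases ht' with rfl | rfl | rfl
    · exact congrArg Subtype.val h₁
    · exact congrArg Subtype.val h₂
    · exact congrArg Subtype.val h₃
  · intro r
    have : (⟨algebraMap K (AlgebraicClosure K) r, IntermediateField.algebraMap_mem _ r⟩ :
        IntermediateField.adjoin K (W.twoTorsionPolynomial.toPoly.rootSet (AlgebraicClosure K))) =
        algebraMap K _ r := rfl
    rw [this, AlgEquiv.commutes]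
    rfl
  · intro a b ha hb iha ihb
    have : (⟨a + b, add_mem ha hb⟩ :
        IntermediateField.adjoin K (W.twoTorsionPolynomial.toPoly.rootSet (AlgebraicClosure K))) =
        ⟨a, ha⟩ + ⟨b, hb⟩ := rfl
    rw [this, map_add]
    push_cast
    rw [iha, ihb]
  · intro a ha iha
    have : (⟨a⁻¹, inv_mem ha⟩ :
        IntermediateField.adjoin K (W.twoTorsionPolynomial.toPoly.rootSet (AlgebraicClosure K))) =
        (⟨a, ha⟩)⁻¹ := rfl
    rw [this, map_inv₀]
    push_cast
    rw [iha]
  · intro a b ha hb iha ihb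
    have : (⟨a * b, mul_mem ha hb⟩ :
        IntermediateField.adjoin K (W.twoTorsionPolynomial.toPoly.rootSet (AlgebraicClosure K))) =
        ⟨a, ha⟩ * ⟨b, hb⟩ := rfl
    rw [this, map_mul]
    push_cast
    rw [iha, ihb]


/-- **`Sw_𝔓(V₂ E) = v(disc) - 2` from an Eisenstein rescaling of the `2`-division cubic.**
Let `E/K` be an elliptic curve over a number field, `v ∣ 3` a finite place, `𝔓 ∣ v`, and suppose
that for some `λ ∈ Kˣ` the monic cubic with roots `θᵢ = λeᵢ` (`eᵢ` the roots of the `2`-division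
cubic `x³ + (b₂/4)x² + (b₄/2)x + b₆/4`), namely `X³ + c₂X² + c₁X + c₀` with `4c₂ = λb₂`,
`2c₁ = λ²b₄`, `4c₀ = λ³b₆`, has coefficients in `𝓞 K` and is **Eisenstein at `v`**.  Then
`Sw_𝔓(V₂ E) = v(disc) - 2`, `disc = c₂²c₁² - 4c₁³ - 4c₂³c₀ - 27c₀² + 18c₂c₁c₀` (`= λ⁶ · 16 Δ`).
This covers the Kodaira types `II` (`λ = 1` at a minimal model: `v(a₃), v(a₄) ≥ 1 = v(a₆)`,
*ATAEC* p. 368 table, `v(Δ) = n`) and `IV*` (`λ = 1/π`: `v(a₂) ≥ 2, v(a₄) ≥ 3, v(a₆) = 4`) of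
Silverman's proof of Ogg's formula for `p = 3`; the Galois side is
`swanConductorAt_rationalTate_two_eq_of_eisenstein` with `F = K(e₁, e₂, e₃)`.
[cite: SilvermanATAEC1994, proof of Thm. IV.11.1 for p = 3 (PDF pp. 366–370)] -/
theorem swanConductorAt_rationalTate_two_eq_of_linear [W.IsElliptic]
    (h : Continuous fun x : absoluteGaloisGroup K × RationalTateModule (geomPoints W) 2 ↦
      rationalTateRepresentation (absoluteGaloisGroup K) (geomPoints W) 2 x.1 x.2)
    {v : HeightOneSpectrum (𝓞 K)} (hv3 : ringChar (𝓞 K ⧸ v.asIdeal) = 3)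
    {𝔓 : Ideal (absIntegers (𝓞 K) K)} (h𝔓 : 𝔓 ∈ v.primesAbove)
    (lam : K) (hlam : lam ≠ 0) {c₂ c₁ c₀ : 𝓞 K}
    (hc₂ : (c₂ : K) * 4 = lam * W.b₂) (hc₁ : (c₁ : K) * 2 = lam ^ 2 * W.b₄)
    (hc₀ : (c₀ : K) * 4 = lam ^ 3 * W.b₆)
    (hv₂ : c₂ ∈ v.asIdeal) (hv₁ : c₁ ∈ v.asIdeal) (hv₀ : c₀ ∈ v.asIdeal) (hv₀' : c₀ ∉ v.asIdeal ^ 2)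
    {n : ℕ} (hn : ord v.asIdeal (c₂ ^ 2 * c₁ ^ 2 - 4 * c₁ ^ 3 - 4 * c₂ ^ 3 * c₀ - 27 * c₀ ^ 2 +
      18 * c₂ * c₁ * c₀) = n) :
    (rationalTateGaloisRepOf (geomPoints W) 2 h).swanConductorAt (𝓞 K) 𝔓 = ((n - 2 : ℕ) : ℝ) := by
  -- the roots `eᵢ` of the `2`-division cubic
  set φ := algebraMap K (AlgebraicClosure K) with hφ
  have ha : W.twoTorsionPolynomial.a ≠ 0 := by
    show (4 : K) ≠ 0
    norm_num
  have hsplit : (W.twoTorsionPolynomial.toPoly.map φ).Splits := IsAlgClosed.splits _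
  obtain ⟨e₁, e₂, e₃, h3⟩ := (Cubic.splits_iff_roots_eq_three ha).mp hsplit
  have hdisc : W.twoTorsionPolynomial.discr ≠ 0 := by
    rw [twoTorsionPolynomial_discr]
    exact mul_ne_zero (by norm_num) W.isUnit_Δ.ne_zero
  obtain ⟨h12, h13, h23⟩ := (Cubic.discr_ne_zero_iff_roots_ne ha h3).mp hdisc
  have hsum : 4 * (e₁ + e₂ + e₃) = -φ W.b₂ := by
    have hb := Cubic.b_eq_three_roots ha h3
    simp only [twoTorsionPolynomial, map_ofNat] at hb
    linear_combination hb
  have hsum2 : 4 * (e₁ * e₂ + e₁ * e₃ + e₂ * e₃) = 2 * φ W.b₄ := by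
    have hc := Cubic.c_eq_three_roots ha h3
    simp only [twoTorsionPolynomial, map_ofNat, map_mul] at hc
    linear_combination (-1 : AlgebraicClosure K) * hc
  have hprod : 4 * (e₁ * e₂ * e₃) = -φ W.b₆ := by
    have hd := Cubic.d_eq_three_roots ha h3
    simp only [twoTorsionPolynomial, map_ofNat] at hd
    linear_combination hd
  have cancel4 : ∀ {x y : AlgebraicClosure K}, 4 * x = 4 * y → x = y :=
    fun hxy ↦ mul_left_cancel₀ (by norm_num : (4 : AlgebraicClosure K) ≠ 0) hxy
  -- the `2`-division field `F = K(e₁, e₂, e₃)`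
  set Q : K[X] := W.twoTorsionPolynomial.toPoly with hQ
  set F : IntermediateField K (AlgebraicClosure K) :=
    IntermediateField.adjoin K (Q.rootSet (AlgebraicClosure K)) with hF
  haveI hsf : Q.IsSplittingField K F :=
    IntermediateField.adjoin_rootSet_isSplittingField (IsAlgClosed.splits _)
  haveI hN : Normal K F := Normal.of_isSplittingField Q
  haveI hFD : FiniteDimensional K F := Polynomial.IsSplittingField.finiteDimensional F Q
  haveI : IsGalois K F := IsGalois.mk
  have hRS := W.rootSet_twoTorsionPolynomial_eq h3
  have he₁ : e₁ ∈ F := IntermediateField.subset_adjoin K _ (by rw [hRS]; simp)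
  have he₂ : e₂ ∈ F := IntermediateField.subset_adjoin K _ (by rw [hRS]; simp)
  have he₃ : e₃ ∈ F := IntermediateField.subset_adjoin K _ (by rw [hRS]; simp)
  have hFgen : ∀ g : F ≃ₐ[K] F, g ⟨e₁, he₁⟩ = ⟨e₁, he₁⟩ → g ⟨e₂, he₂⟩ = ⟨e₂, he₂⟩ →
      g ⟨e₃, he₃⟩ = ⟨e₃, he₃⟩ → g = 1 :=
    fun g ↦ W.algEquiv_eq_one_of_apply_roots_eq h3 hF he₁ he₂ he₃ g
  -- the integers `θᵢ = λ eᵢ`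
  have hev : ∀ {e : AlgebraicClosure K}, (e = e₁ ∨ e = e₂ ∨ e = e₃) →
      4 * e ^ 3 + φ W.b₂ * e ^ 2 + 2 * φ W.b₄ * e + φ W.b₆ = 0 :=
    fun hor ↦ eval_eq_zero_of_roots_eq h3 hor
  have hc₂' : φ c₂ * 4 = φ lam * φ W.b₂ := by rw [← map_ofNat φ 4, ← map_mul, ← map_mul, hc₂]
  have hc₁' : φ c₁ * 2 = φ lam ^ 2 * φ W.b₄ := by
    rw [← map_ofNat φ 2, ← map_mul, ← map_pow, ← map_mul, hc₁]
  have hc₀' : φ c₀ * 4 = φ lam ^ 3 * φ W.b₆ := by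
    rw [← map_ofNat φ 4, ← map_mul, ← map_pow, ← map_mul, hc₀]
  have hθroot : ∀ {e : AlgebraicClosure K}, (e = e₁ ∨ e = e₂ ∨ e = e₃) →
      (φ lam * e) ^ 3 + φ c₂ * (φ lam * e) ^ 2 + φ c₁ * (φ lam * e) + φ c₀ = 0 := by
    intro e hor
    apply cancel4
    rw [mul_zero]
    linear_combination (φ lam ^ 2 * e ^ 2) * hc₂' + (2 * φ lam * e) * hc₁' + hc₀' +
      (φ lam ^ 3) * hev hor
  have hmemF : ∀ {e : AlgebraicClosure K}, e ∈ F → φ lam * e ∈ F :=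
    fun he ↦ mul_mem (IntermediateField.algebraMap_mem F lam) he
  have hint : ∀ {e : AlgebraicClosure K} (he : e ∈ F), (e = e₁ ∨ e = e₂ ∨ e = e₃) →
      _root_.IsIntegral (𝓞 K) (⟨φ lam * e, hmemF he⟩ : F) := by
    intro e he hor
    refine ⟨Cubic.toPoly ⟨1, c₂, c₁, c₀⟩, Cubic.monic_of_a_eq_one rfl, ?_⟩
    apply (algebraMap F (AlgebraicClosure K)).injective
    rw [Polynomial.hom_eval₂, map_zero]
    have hcomp : (algebraMap F (AlgebraicClosure K)).comp (algebraMap (𝓞 K) F) =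
        algebraMap (𝓞 K) (AlgebraicClosure K) := RingHom.ext fun x ↦ rfl
    rw [hcomp]
    change Polynomial.eval₂ (algebraMap (𝓞 K) (AlgebraicClosure K)) (φ lam * e) _ = 0
    simp only [Cubic.toPoly, eval₂_add, eval₂_mul, eval₂_C, eval₂_pow, eval₂_X, map_one, one_mul]
    have hK : ∀ c : 𝓞 K, algebraMap (𝓞 K) (AlgebraicClosure K) c = φ c := fun c ↦ rfl
    rw [hK, hK, hK]
    exact hθroot hor
  set θ₁ : integralClosure (𝓞 K) F := ⟨⟨φ lam * e₁, hmemF he₁⟩, hint he₁ (Or.inl rfl)⟩ with hθ₁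
  set θ₂ : integralClosure (𝓞 K) F := ⟨⟨φ lam * e₂, hmemF he₂⟩, hint he₂ (Or.inr (Or.inl rfl))⟩
    with hθ₂
  set θ₃ : integralClosure (𝓞 K) F := ⟨⟨φ lam * e₃, hmemF he₃⟩, hint he₃ (Or.inr (Or.inr rfl))⟩
    with hθ₃
  have hcoe : ∀ c : 𝓞 K, (((algebraMap (𝓞 K) (integralClosure (𝓞 K) F) c :
      integralClosure (𝓞 K) F) : F) : AlgebraicClosure K) = φ c := fun c ↦ rfl
  have hlam' : φ lam ≠ 0 := (map_ne_zero φ).mpr hlam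
  -- Vieta, distinctness, `θ`'s determine `e`'s
  have hV₁ : θ₁ + θ₂ + θ₃ = -algebraMap (𝓞 K) _ c₂ := by
    apply Subtype.ext; apply Subtype.ext
    change φ lam * e₁ + φ lam * e₂ + φ lam * e₃ = -((((algebraMap (𝓞 K) (integralClosure (𝓞 K) F)
      c₂ : integralClosure (𝓞 K) F) : F) : AlgebraicClosure K))
    rw [hcoe]
    apply cancel4
    linear_combination (φ lam) * hsum + hc₂'
  have hV₂ : θ₁ * θ₂ + θ₁ * θ₃ + θ₂ * θ₃ = algebraMap (𝓞 K) _ c₁ := by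
    apply Subtype.ext; apply Subtype.ext
    change φ lam * e₁ * (φ lam * e₂) + φ lam * e₁ * (φ lam * e₃) + φ lam * e₂ * (φ lam * e₃) =
      (((algebraMap (𝓞 K) (integralClosure (𝓞 K) F) c₁ : integralClosure (𝓞 K) F) : F) :
        AlgebraicClosure K)
    rw [hcoe]
    apply cancel4
    linear_combination (φ lam ^ 2) * hsum2 - 2 * hc₁'
  have hV₃ : θ₁ * θ₂ * θ₃ = -algebraMap (𝓞 K) _ c₀ := by
    apply Subtype.ext; apply Subtype.ext
    change φ lam * e₁ * (φ lam * e₂) * (φ lam * e₃) = -((((algebraMap (𝓞 K)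
      (integralClosure (𝓞 K) F) c₀ : integralClosure (𝓞 K) F) : F) : AlgebraicClosure K))
    rw [hcoe]
    apply cancel4
    linear_combination (φ lam ^ 3) * hprod + hc₀'
  have hne : ∀ {x y : AlgebraicClosure K} (hx : x ∈ F) (hy : y ∈ F) (ix : _root_.IsIntegral (𝓞 K)
      (⟨φ lam * x, hmemF hx⟩ : F)) (iy : _root_.IsIntegral (𝓞 K) (⟨φ lam * y, hmemF hy⟩ : F)),
      x ≠ y →
      (⟨⟨φ lam * x, hmemF hx⟩, ix⟩ : integralClosure (𝓞 K) F) ≠ ⟨⟨φ lam * y, hmemF hy⟩, iy⟩ := by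
    intro x y hx hy ix iy hxy heq
    have := congrArg (fun t : integralClosure (𝓞 K) F ↦ ((t : F) : AlgebraicClosure K)) heq
    exact hxy (mul_left_cancel₀ hlam' this)
  have hθe : ∀ g : F ≃ₐ[K] F, g • θ₁ = θ₁ → g • θ₂ = θ₂ → g • θ₃ = θ₃ →
      g ⟨e₁, he₁⟩ = ⟨e₁, he₁⟩ ∧ g ⟨e₂, he₂⟩ = ⟨e₂, he₂⟩ ∧ g ⟨e₃, he₃⟩ = ⟨e₃, he₃⟩ := by
    have key : ∀ {e : AlgebraicClosure K} (he : e ∈ F) (ie : _root_.IsIntegral (𝓞 K)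
        (⟨φ lam * e, hmemF he⟩ : F)) (g : F ≃ₐ[K] F),
        g • (⟨⟨φ lam * e, hmemF he⟩, ie⟩ : integralClosure (𝓞 K) F) = ⟨⟨φ lam * e, hmemF he⟩, ie⟩ →
        g ⟨e, he⟩ = ⟨e, he⟩ := by
      intro e he ie g hg
      have hg' := congrArg (fun t : integralClosure (𝓞 K) F ↦ (t : F)) hg
      change g ⟨φ lam * e, hmemF he⟩ = ⟨φ lam * e, hmemF he⟩ at hg'
      have hsplit : (⟨φ lam * e, hmemF he⟩ : F) = algebraMap K F lam * ⟨e, he⟩ := rfl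
      rw [hsplit, map_mul, AlgEquiv.commutes] at hg'
      exact mul_left_cancel₀ (by exact (map_ne_zero (algebraMap K F)).mpr hlam) hg'
    intro g g1 g2 g3
    exact ⟨key he₁ _ g g1, key he₂ _ g g2, key he₃ _ g g3⟩
  exact W.swanConductorAt_rationalTate_two_eq_of_eisenstein h hv3 h𝔓 F h3 he₁ he₂ he₃ hFgen hV₁ hV₂ hV₃
    hv₂ hv₁ hv₀ hv₀' (hne he₁ he₂ _ _ h12) (hne he₁ he₃ _ _ h13) (hne he₂ he₃ _ _ h23) hθe hn

end WeierstrassCurve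

end
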